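import Summits.QuantumFields.YangMills.Theorems.AlphaInputsT3ACv3StartSystemBox
import HarnessLib

/-!
# `AlphaInputsT3ACv3StartSystemSepChart` — non-abelian (FL), START v3 row (S5)-4b (hsep), part 1: **THE CHART OF AN ACTIVE TUBE BOND AND THE LABEL-COMPARISON LETTER** — (i) an active bond of
# the tube `Q` is a TRANSVERSE bond charted at `boxSite (cornerSite Q) w` with `|w_μ|, |w_ν| ≤ 2r` and a quadrant endpoint (★w2's opening of `hbox_of_corners`, exported once as a lemma);
# (ii) two fine labels `a·Lᵏ + s`, `a′·Lᵏ + s′` that agree modulo `N₀ = N_k·Lᵏ` with `|s − s′| < Lᵏ` have `a = a′` (`a, a′ < N_k`), and with `|s − s′| < 2Lᵏ` have `a′ ≡ a + ε (mod N_k)`,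
# `ε ∈ {−1, 0, 1}` — the arithmetic behind «two tubes active on one plaquette sit at the same or at adjacent cells» — cell `ym3-torus`, width seat `ym-ust-19936-w5` (g2); (hsep) assigned by
# ★★OWNER 03:48:39Z, case analysis LOCATED on the bus 04:0xZ

HONEST FRAMING.  Chart bookkeeping; part 2 (`…StartSystemSep`: the parallel∕crossing case analysis and the quadrant rule at boundary vertices) is the remaining work of (hsep).  Count-neutral helper
toward R3 2′ (items 19936∕19935, `--supports stmt-QuantumFields-19936`); `hLift`∕(FL), the stub, the crux and the gap are NOT claimed; registry untouched; YM₃ on T³ is rung R3, not Clay.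

References: T. Bałaban, Commun. Math. Phys. 102 (1985) 277–309 [Balaban1985Variational] ((11), (14) pp.279–280); Commun. Math. Phys. 109 (1987) 249–301 [Balaban1987RG1] ((0.1) p.251).
-/

set_option autoImplicit false

noncomputable section

namespace Summit.QuantumFields.YangMills.Theorems.TubeStart

open Literature.MathematicalPhysics.QuantumFieldTheory.Balaban1983to89
open Literature.MathematicalPhysics.QuantumFieldTheory.Balaban1983to89.T4AdjointCovarianceUnitary (lieSU expSU)
open Literature.MathematicalPhysics.QuantumFieldTheory.Balaban1983to89.BlockAveragingSectionAction (iterSec)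
open Literature.MathematicalPhysics.QuantumFieldTheory.Balaban1983to89.B10Eq38TorusDomains (toFine plaqsIn cornerSet mem_plaqsIn_iff)
open Summit.QuantumFields.Balaban3D.Carriers
open Summit.QuantumFields.YangMills.Theorems.ModelBox
open Summit.QuantumFields.YangMills.Theorems.TubeProfile (betaQB betaQB_touches betaQB_window)

variable {P : Params} {k : ℕ}

/-! ## §1 The chart of an active bond -/

section Chart

variable {n : Type*} [Fintype n] [DecidableEq n] [Nonempty n]
variable (σ : Plaq P k → Bool × Bool) (r : ℕ) (V : GaugeField P k (Matrix.specialUnitaryGroup n ℂ)) (Rt : ℕ) (Fp : Plaq P k → lieSU n)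

/-- **★ THE CHART OF AN ACTIVE TUBE BOND**: an active bond `b` of the tube `Q` (profile `stringInd + β_Q` with quadrant `σ Q`) is TRANSVERSE (`b.dir ∈ {Q.μ, Q.ν}`), charted at
`b.src = boxSite (cornerSite Q) w` with `w`, `w + e_{b.dir}` in the tube box, `|w_μ|, |w_ν| ≤ 2r`, and one endpoint `p ∈ {w, w + e_{b.dir}}` in the quadrant `σ Q`.
[cite: Balaban1985Variational, (11)+(14) pp.279–280] -/
theorem chart_of_tubeActive (hk : k ≤ P.m + P.K) (hRt : Rt + 2 ≤ P.L ^ k) (hN : 2 * max Rt (P.L ^ k / 2) + 1 ≤ P.sitesPerDir 0) {Q : Plaq P k}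
    (hF : expSU (Fp Q) = V ⟨Q.src, Q.ν⟩ * V ⟨Q.src.shift Q.ν, Q.μ⟩ * (V ⟨Q.src.shift Q.μ, Q.ν⟩)⁻¹ * (V ⟨Q.src, Q.μ⟩)⁻¹) {IsTube : Plaq P k → Prop} {b : PBond P 0}
    (hact : TubeActive V Rt Fp (fun Q => stringInd Q.μ Q.ν + betaQB r (σ Q).1 (σ Q).2 Q.μ Q.ν) IsTube Q b) :
    ∃ w : Fin P.d → ℤ, InTube Q.μ Q.ν Rt (P.L ^ k / 2) w ∧ InTube Q.μ Q.ν Rt (P.L ^ k / 2) (w + e b.dir) ∧ boxSite (cornerSite k Q.src Q.μ Q.ν) w = b.src ∧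
      (b.dir = Q.μ ∨ b.dir = Q.ν) ∧ |w Q.μ| ≤ 2 * (r : ℤ) ∧ |w Q.ν| ≤ 2 * (r : ℤ) ∧
      ∃ p : Fin P.d → ℤ, (p = w ∨ p = w + e b.dir) ∧ ((if (σ Q).1 then p Q.μ ≤ 0 else 1 ≤ p Q.μ) ∧ (if (σ Q).2 then p Q.ν ≤ 0 else 1 ≤ p Q.ν)) := by
  have hμν : Q.μ ≠ Q.ν := ne_of_lt Q.hμν
  obtain ⟨w, hwT, hwT', hbw, hts⟩ := exists_chart_of_tubeActive V Rt Fp _ _ hk hRt hN hF hact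
  have hβ : betaQB r (σ Q).1 (σ Q).2 Q.μ Q.ν w b.dir ≠ 0 := by
    intro h0; apply hts
    show (stringInd Q.μ Q.ν + betaQB r (σ Q).1 (σ Q).2 Q.μ Q.ν) w b.dir = _
    rw [Pi.add_apply, Pi.add_apply, h0, add_zero]
  obtain ⟨hwμ, hwν⟩ := betaQB_window r _ _ Q.μ Q.ν hβ
  obtain ⟨hdir, hquad⟩ := betaQB_touches r _ _ Q.μ Q.ν hμν hβ
  refine ⟨w, hwT, hwT', hbw, hdir, hwμ, hwν, ?_⟩
  rcases hquad with hq | hq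
  · exact ⟨w, Or.inl rfl, hq⟩
  · exact ⟨w + e b.dir, Or.inr rfl, hq⟩

end Chart

/-! ## §2 Labels: same cell or adjacent cells -/

/-- **★ TWO FINE LABELS THAT AGREE ON THE TORUS SIT IN CELLS AT MOST ONE APART**: if `a·Lᵏ + s ≡ a′·Lᵏ + s′ (mod N₀)`, `N₀ = N_k·Lᵏ`, `a, a′ < N_k` and `|s − s′| < 2Lᵏ`, then
`a′ − a − c·N_k ∈ {−1, 0, 1}` for the integer `c` with `(a′ − a − cN_k)·Lᵏ = s − s′`; in particular `|s − s′| < Lᵏ ⟹ a = a′`. [cite: Balaban1987RG1, (0.1) p.251] -/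
theorem natLabel_eq_of_intCast_eq (hNk : P.sitesPerDir 0 = P.sitesPerDir k * P.L ^ k) {a a' : ℕ} (ha : a < P.sitesPerDir k) (ha' : a' < P.sitesPerDir k) {s s' : ℤ}
    (hs : |s - s'| < (P.L ^ k : ℕ)) (h : (((a * P.L ^ k : ℕ) : ℤ) + s : ZMod (P.sitesPerDir 0)) = (((a' * P.L ^ k : ℕ) : ℤ) + s' : ZMod (P.sitesPerDir 0))) : a = a' := by
  have h' : ((((a * P.L ^ k : ℕ) : ℤ) + s : ℤ) : ZMod (P.sitesPerDir 0)) = ((((a' * P.L ^ k : ℕ) : ℤ) + s' : ℤ) : ZMod (P.sitesPerDir 0)) := by push_cast at h ⊢; exact h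
  rw [ZMod.intCast_eq_intCast_iff_dvd_sub] at h'
  obtain ⟨c, hcdiv⟩ := h'
  have hNk' : ((P.sitesPerDir 0 : ℕ) : ℤ) = (P.sitesPerDir k : ℤ) * ((P.L ^ k : ℕ) : ℤ) := by exact_mod_cast hNk
  have hLk : (0 : ℤ) < ((P.L ^ k : ℕ) : ℤ) := by exact_mod_cast pow_pos P.L_pos k
  have hya : (a : ℤ) < P.sitesPerDir k := by exact_mod_cast ha
  have hya' : (a' : ℤ) < P.sitesPerDir k := by exact_mod_cast ha'
  push_cast at hcdiv
  rw [hNk'] at hcdiv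
  have hcast : ((P.L : ℤ)) ^ k = ((P.L ^ k : ℕ) : ℤ) := by push_cast; ring
  rw [hcast] at hcdiv
  have key : ((a' : ℤ) - a - c * (P.sitesPerDir k : ℤ)) * ((P.L ^ k : ℕ) : ℤ) = s - s' := by linear_combination hcdiv
  have hzero : (a' : ℤ) - a - c * (P.sitesPerDir k : ℤ) = 0 := by
    by_contra hne
    have h1 : (1 : ℤ) ≤ |(a' : ℤ) - a - c * (P.sitesPerDir k : ℤ)| := Int.one_le_abs hne
    have h2 : ((P.L ^ k : ℕ) : ℤ) ≤ |s - s'| := by rw [← key, abs_mul, abs_of_pos hLk]; nlinarith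
    linarith
  have hNk0 : (0 : ℤ) ≤ (P.sitesPerDir k : ℤ) := Nat.cast_nonneg _
  have hc0 : c = 0 := by
    rcases lt_trichotomy c 0 with hc | hc | hc
    · have : c * (P.sitesPerDir k : ℤ) ≤ -1 * (P.sitesPerDir k : ℤ) := mul_le_mul_of_nonneg_right (by omega) hNk0
      have : (0 : ℤ) ≤ a := Nat.cast_nonneg _; linarith
    · exact hc
    · have : 1 * (P.sitesPerDir k : ℤ) ≤ c * (P.sitesPerDir k : ℤ) := mul_le_mul_of_nonneg_right (by omega) hNk0
      have : (0 : ℤ) ≤ a' := Nat.cast_nonneg _; linarith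
  rw [hc0, zero_mul, sub_zero, sub_eq_zero] at hzero
  exact_mod_cast hzero.symm

/-- The two-cell version: with `|s − s′| < 2Lᵏ` the cells are equal or adjacent modulo `N_k`: `(a′ : ZMod N_k) = a + ε` for some `ε ∈ {−1, 0, 1}` with `ε·Lᵏ = s − s′ (mod N₀-lift)`.
[cite: Balaban1987RG1, (0.1) p.251] -/
theorem natLabel_adj_of_intCast_eq (hNk : P.sitesPerDir 0 = P.sitesPerDir k * P.L ^ k) {a a' : ℕ} {s s' : ℤ}
    (hs : |s - s'| < 2 * (P.L ^ k : ℕ)) (h : (((a * P.L ^ k : ℕ) : ℤ) + s : ZMod (P.sitesPerDir 0)) = (((a' * P.L ^ k : ℕ) : ℤ) + s' : ZMod (P.sitesPerDir 0))) :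
    ∃ ε : ℤ, (ε = -1 ∨ ε = 0 ∨ ε = 1) ∧ ((a' : ℤ) : ZMod (P.sitesPerDir k)) = (((a : ℤ) + ε : ℤ) : ZMod (P.sitesPerDir k)) ∧ ε * ((P.L ^ k : ℕ) : ℤ) = s - s' := by
  have h' : ((((a * P.L ^ k : ℕ) : ℤ) + s : ℤ) : ZMod (P.sitesPerDir 0)) = ((((a' * P.L ^ k : ℕ) : ℤ) + s' : ℤ) : ZMod (P.sitesPerDir 0)) := by push_cast at h ⊢; exact h
  rw [ZMod.intCast_eq_intCast_iff_dvd_sub] at h'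
  obtain ⟨c, hcdiv⟩ := h'
  have hNk' : ((P.sitesPerDir 0 : ℕ) : ℤ) = (P.sitesPerDir k : ℤ) * ((P.L ^ k : ℕ) : ℤ) := by exact_mod_cast hNk
  have hLk : (0 : ℤ) < ((P.L ^ k : ℕ) : ℤ) := by exact_mod_cast pow_pos P.L_pos k
  push_cast at hcdiv
  rw [hNk'] at hcdiv
  have hcast : ((P.L : ℤ)) ^ k = ((P.L ^ k : ℕ) : ℤ) := by push_cast; ring
  rw [hcast] at hcdiv
  have key : ((a' : ℤ) - a - c * (P.sitesPerDir k : ℤ)) * ((P.L ^ k : ℕ) : ℤ) = s - s' := by linear_combination hcdiv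
  set ε : ℤ := (a' : ℤ) - a - c * (P.sitesPerDir k : ℤ) with hε
  have hεabs : |ε| ≤ 1 := by
    by_contra hne
    have h2 : (2 : ℤ) ≤ |ε| := by omega
    have h3 : 2 * ((P.L ^ k : ℕ) : ℤ) ≤ |s - s'| := by rw [← key, abs_mul, abs_of_pos hLk]; nlinarith
    linarith
  refine ⟨ε, by rw [abs_le] at hεabs; omega, ?_, key⟩
  rw [ZMod.intCast_eq_intCast_iff_dvd_sub]
  exact ⟨-c, by rw [hε]; ring⟩

end Summit.QuantumFields.YangMills.Theorems.TubeStart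

end
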